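import Mathlib
import HarnessLib
import Summits.Ventures.LatticeQCDFlow.Exactness.U1WilsonFlowLOExactForceErgodic
import Summits.Ventures.LatticeQCDFlow.Exactness.WilsonFlowMasks

/-!
# Non-vacuity on the STEP-0 `U(1)` configuration WITH THE ENGINE'S EXACT AUTODIFF FORCE at every `nstep`: FT-HMC through the LO member (2-d torus, parity masks, sweep schedule) converges to the `U(1)` Wilson measure from every start in an explicit short-trajectory window

HONEST FRAMING: exact (Metropolis-corrected) sampling algorithms for lattice gauge theory;
figures of merit are autocorrelation/cost numbers at stated couplings and volumes; no
continuum-physics claim.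

Venture `LatticeQCDFlow` (cell pub-lqcd), topic `Exactness`, FANOUT row 14 (`eng-flowhmc`, `U(1)` rung
= the STEP-0 configuration of rows 3 / 4: 2-d `U(1)` on `L × L`, `L` even; member
`maps.u1_wilson_flow_lo` with parity masks and the sweep schedule `(0, even), (0, odd), (1, even),
(1, odd)` per sweep, `nsweeps` sweeps; momentum increment = the engine's autodiff force
`κ_f · fderiv (p ↦ (β S_W∘F − log J)(e^(icp)·V)) 0 (δ_e)`).  NEW WORK of the cell over this row's
`U1WilsonFlowLOExactForceErgodic` and GEN-7's `WilsonFlowMasks` (`exists_parityMask`); nothing is cited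
as a fact; no number.  The exact-force twin of GEN-12's `U1StepZeroMultiStepErgodic` (there the
increment was ANY `K`-Lipschitz bounded `g`; here it is the engine's, and `K` is computed).

* **`u1_fthmcN_stepZeroLattice_wilson_exactForce_uniformlyErgodic`** — for every even `L`, `2|ε| < 1`,
  `nsweeps`, `β, c, κ_f`, `ε', κ' > 0`, `n ≥ 1` with

    `4 · K̄ · ε' · n² ≤ 3`,
    `K̄ = (1+8|ε|)^(8·nsweeps) · (8|βcκ_f| + 4nsweeps·(32|ε|(2|βcκ_f| + 4nsweeps·u) + w))`,
    `u = 8|κ_f||c||ε|/(1 − 2|ε|)`, `w = |κ_f||c||ε|(32/(1 − 2|ε|) + 64|ε|/(1 − 2|ε|)²)`,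

  there is a parity colouring `χ` and a list of `4·nsweeps` certified layers whose maps / densities
  ARE the masked `U(1)` Wilson-flow sub-steps / booked Jacobians of the schedule (VERBATIM as in
  `exists_layers_u1WilsonFlowLO`) such that the `n`-step FT-HMC chain with the EXACT force, reported
  through the member, satisfies `|μ₀K̃ᵗ(A) − μ_{Λ,β}(A)| ≤ (1 − δ)ᵗ` for some `δ ∈ (0, 1]`, EVERY
  initial law, every `t`, every `A` (`μ_{Λ,β} = wilsonMeasure u1Rep β`).  Nothing left to assume but
  `L` even, `2|ε| < 1` and the explicit window — uniform in `L`.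

NOT CLAIMED: longer trajectories; sharp constants; `τ_int` / acceptance numbers of the STEP-0 runs;
floating point; any number.
-/

noncomputable section

namespace Summit.Ventures.LatticeQCDFlow.Exactness

open Set MeasureTheory
open ProbabilityTheory ProbabilityTheory.Kernel
open Literature.MathematicalPhysics.QuantumFieldTheory Literature.MathematicalPhysics.QuantumLattice
open scoped ENNReal NNReal

set_option maxHeartbeats 400000 in -- RN-23 (7)(b): heavy declaration budgeted at source (lake build ≈ 10 % hungrier than the gate)
/-- **STEP-0 `U(1)` configuration (2-d, `L` even, parity masks, sweep schedule, `2|ε| < 1`,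
`S = β·S_W`, the engine's EXACT force) AT EVERY `nstep` in the explicit window: multi-step FT-HMC
through the LO member converges to the `U(1)` Wilson measure from every start** (see the module
docstring). -/
theorem u1_fthmcN_stepZeroLattice_wilson_exactForce_uniformlyErgodic {L : ℕ} [NeZero L] (hL : Even L)
    {ε : ℝ} (hε : |ε| * 2 < 1) (nsweeps : ℕ) (β c κf : ℝ) {ε' κ' : ℝ} (hε' : 0 < ε') (hκ' : 0 < κ')
    {n : ℕ} (hn : 1 ≤ n)
    (hshort : 4 * ((1 + 8 * |ε|) ^ (2 * (4 * nsweeps)) *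
        (8 * |β * c * κf| + 4 * (nsweeps : ℝ) * (4 * (8 * |ε|) *
          (2 * |β * c * κf| + 4 * (nsweeps : ℝ) * (|κf| * |c| * |ε| * 8 / (1 - |ε| * 2))) +
           |κf| * |c| * |ε| * (32 / (1 - |ε| * 2) + 64 * |ε| / (1 - |ε| * 2) ^ 2)))) *
        ε' * (n : ℝ) ^ 2 ≤ 3) :
    ∃ χ : Site 2 L → ZMod 2, (∀ (x : Site 2 L) (i : Fin 2), χ (x.shift i) ≠ χ x) ∧
    ∃ layers : List ((GaugeConfig 2 L Circle ≃ᵐ GaugeConfig 2 L Circle) × (GaugeConfig 2 L Circle → ℝ)),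
      layers.map (fun Ly => ((Ly.1 : GaugeConfig 2 L Circle → GaugeConfig 2 L Circle), Ly.2)) =
        ((List.replicate nsweeps ((List.finRange 2).flatMap fun μ : Fin 2 =>
          [(μ, (0 : ZMod 2)), (μ, 1)])).flatten).map (fun s =>
        ((fun (V : GaugeConfig 2 L Circle) (e : Edge 2 L) => if e.2 = s.1 ∧ χ e.1 = s.2 then
          V e * Circle.exp (ε * ∑ ν ∈ Finset.univ.erase e.2,
            (((plaquetteHolonomy V (e.1 - Pi.single ν 1) e.2 ν : Circle) : ℂ).im -
              ((plaquetteHolonomy V e.1 e.2 ν : Circle) : ℂ).im)) else V e),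
         fun V : GaugeConfig 2 L Circle => ∏ a : {e : Edge 2 L // e.2 = s.1 ∧ χ e.1 = s.2},
          (1 - ε * ∑ ν ∈ Finset.univ.erase a.1.2,
            (((plaquetteHolonomy V a.1.1 a.1.2 ν : Circle) : ℂ).re +
              ((plaquetteHolonomy V (a.1.1 - Pi.single ν 1) a.1.2 ν : Circle) : ℂ).re)))) ∧
      layers.length = 4 * nsweeps ∧
      ∃ hg : Measurable (fun V : GaugeConfig 2 L Circle => (fun i : Edge 2 L => κf * fderiv ℝ (fun p : (Edge 2 L → ℝ) =>
        (fun W : GaugeConfig 2 L Circle => β * wilsonAction u1Rep ((layers.foldr (fun Ly (F : GaugeConfig 2 L Circle ≃ᵐ GaugeConfig 2 L Circle) => Ly.1.trans F) (MeasurableEquiv.refl (GaugeConfig 2 L Circle))) W) - Real.log ((layers.foldr (fun Ly K => fun v => Ly.2 v * K (Ly.1 v)) (fun _ => (1 : ℝ))) W)) ((fun i : Edge 2 L => Circle.exp (c * p i)) * V)) 0 (Pi.single i 1))),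
      ∃ δ : ℝ, 0 < δ ∧ δ ≤ 1 ∧ ∀ (μ₀ : Measure (GaugeConfig 2 L Circle)) [IsProbabilityMeasure μ₀]
        (t : ℕ) (A : Set (GaugeConfig 2 L Circle)),
        |((fun m : Measure (GaugeConfig 2 L Circle) =>
              m.bind (conjKernel (u1LeapfrogHMCN ε' κ' hg (fun V =>
                  β * wilsonAction u1Rep ((layers.foldr
                    (fun Ly (F : GaugeConfig 2 L Circle ≃ᵐ GaugeConfig 2 L Circle) => Ly.1.trans F)
                    (MeasurableEquiv.refl (GaugeConfig 2 L Circle))) V) -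
                    Real.log ((layers.foldr (fun Ly K => fun v => Ly.2 v * K (Ly.1 v))
                      (fun _ => (1 : ℝ))) V)) n)
                (layers.foldr (fun Ly (F : GaugeConfig 2 L Circle ≃ᵐ GaugeConfig 2 L Circle) =>
                  Ly.1.trans F) (MeasurableEquiv.refl (GaugeConfig 2 L Circle)))))^[t] μ₀).real A
            - (wilsonMeasure (d := 2) (L := L) u1Rep β).real A| ≤ (1 - δ) ^ t := by
  obtain ⟨χ, hχ⟩ := exists_parityMask (d := 2) (L := L) hL
  refine ⟨χ, hχ, ?_⟩
  have hL2 : 2 ≤ L := by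
    obtain ⟨k, hk⟩ := hL
    have h0 : L ≠ 0 := NeZero.ne L
    omega
  have hε2 : |ε| * (2 * ((2 - 1 : ℕ) : ℝ)) < 1 := by norm_num; linarith
  have hlen : ((List.replicate nsweeps ((List.finRange 2).flatMap fun μ : Fin 2 =>
      [(μ, (0 : ZMod 2)), (μ, 1)])).flatten).length = 4 * nsweeps := by
    simp [List.length_flatten, List.length_flatMap, mul_comm]
  have hshort' : 4 * ((1 + 8 * ((2 - 1 : ℕ) : ℝ) * |ε|) ^ (2 * ((List.replicate nsweeps
      ((List.finRange 2).flatMap fun μ : Fin 2 => [(μ, (0 : ZMod 2)), (μ, 1)])).flatten).length) *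
        (8 * ((2 - 1 : ℕ) : ℝ) * |β * c * κf| + (((List.replicate nsweeps
          ((List.finRange 2).flatMap fun μ : Fin 2 => [(μ, (0 : ZMod 2)), (μ, 1)])).flatten).length : ℝ) *
          (4 * (8 * ((2 - 1 : ℕ) : ℝ) * |ε|) *
            (2 * ((2 - 1 : ℕ) : ℝ) * |β * c * κf| + (((List.replicate nsweeps
              ((List.finRange 2).flatMap fun μ : Fin 2 => [(μ, (0 : ZMod 2)), (μ, 1)])).flatten).length : ℝ) *
              (|κf| * |c| * |ε| * (8 * ((2 - 1 : ℕ) : ℝ)) / (1 - |ε| * (2 * ((2 - 1 : ℕ) : ℝ))))) +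
           |κf| * |c| * |ε| * (32 * ((2 - 1 : ℕ) : ℝ) / (1 - |ε| * (2 * ((2 - 1 : ℕ) : ℝ))) +
             64 * ((2 - 1 : ℕ) : ℝ) ^ 2 * |ε| / (1 - |ε| * (2 * ((2 - 1 : ℕ) : ℝ))) ^ 2)))) *
        ε' * (n : ℝ) ^ 2 ≤ 3 := by
    rw [hlen]
    have hD : ((2 - 1 : ℕ) : ℝ) = 1 := by norm_num
    rw [hD]
    push_cast
    simp only [mul_one, one_pow]
    convert hshort using 4
  obtain ⟨layers, hmap, hg, δ, hδ0, hδ1, hbound⟩ :=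
    u1WilsonFlowLO_member_fthmcN_exactForce_uniformlyErgodic χ hL2 hχ hε2
      ((List.replicate nsweeps ((List.finRange 2).flatMap fun μ : Fin 2 =>
        [(μ, (0 : ZMod 2)), (μ, 1)])).flatten) β c κf hε' hκ' hn hshort'
  refine ⟨layers, hmap, ?_, hg, δ, hδ0, hδ1, hbound⟩
  have h := congrArg List.length hmap
  rw [List.length_map, List.length_map] at h
  rw [h, hlen]

end Summit.Ventures.LatticeQCDFlow.Exactness
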